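import Literature.Barriers.CriticalPhenomena.TimarTargetForest
import Mathlib.Combinatorics.SimpleGraph.Metric
import Mathlib.Logic.Function.Iterate
import HarnessLib

/-!
# Breadth-first parent chains and the median of three leaves — deterministic geometry for the
# local surgery producing encounter points (Timár 2006, §5, Lemma 5.3 / Thm. 5.5)

Barrier catalogue `Literature/Barriers/CriticalPhenomena/`; a deterministic brick of the
programme proving Timár's Thm. 5.5 (`Timar2006_finiteLevelUnion`,
`TimarCriticalNonunimodular.lean`). Timár's Lemma 5.3 ("every heavy cluster in `ω` contains
infinitely many encounter points … The existence of encounter points follows from insertion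
tolerance", Ann. Probab. 34 (2006), p. 2357) is used in the proof of Thm. 5.5 to start the forest
on the encounter points of the bad clusters. The local modification behind "follows from
insertion tolerance" (as in Lyons–Peres 2016, proof of Thm. 7.6, or Burton–Keane) glues three
far-apart pieces of clusters along a tree inside a ball; the gluing vertex is then an encounter
point. This file supplies the tree and its separating vertex, for a connected graph `G` with
base point `o`:

* `bfsParent hconn o v` — for `v ≠ o` a neighbour of `v` one step closer to `o` (a breadth-first
  parent; `bfsParent o = o`), and the ancestor at depth `e`, `atDepth hconn o v e = parent^{d(v)-e} v`
  (`dist_atDepth`: it has depth `e`, for `e ≤ d(o, v)`); chains from a common vertex agree below it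
  (`atDepth_eq_of_atDepth_eq`);
* `chainEdges` (the parent edges of `v`'s chain) and, for three vertices `a b c` at a common
  depth `R`, the tree `tripodEdges = chainEdges a ∪ chainEdges b ∪ chainEdges c`;
* **the median separates** (`exists_median_separates`): for distinct `a b c` at depth `R ≥ 1`
  there is a vertex `m` of the tripod of depth `< R` such that no two of `a, b, c` are joined in the
  tripod by a walk avoiding `m` (in the language of `TimarTargetForest.lean`: `¬ AvoidReach`).
  Proof: let `m` be the deepest common ancestor of the pair with the deepest meeting point, say of
  `a` and `b`; the part of `a`'s chain strictly below… above depth `d(m)` is closed under tripod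
  steps avoiding `m`, and likewise for `b`.

## References

* Á. Timár, Ann. Probab. 34 (2006) 2344–2364, §5, Lemma 5.3 (proof: "follows from insertion
  tolerance") and Thm. 5.5. [Timar2006]
* R. Lyons, Y. Peres, *Probability on Trees and Networks*, CUP 2016, proof of Thm. 7.6
  (furcations by local modification). [LyonsPeres2016]
-/

namespace Literature.Barriers.CriticalPhenomena

open SimpleGraph

variable {V : Type*} {G : SimpleGraph V}

/-! ### Breadth-first parents and ancestors -/

/-- Every vertex other than the base point has a neighbour one step closer to it (the penultimate
vertex of a geodesic). [folklore] -/
theorem exists_adj_dist_add_one (hconn : G.Connected) {o v : V} (hv : v ≠ o) :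
    ∃ w, G.Adj v w ∧ G.dist o w + 1 = G.dist o v := by
  obtain ⟨p, hp⟩ := hconn.exists_walk_length_eq_dist v o
  cases p with
  | nil => exact absurd rfl hv
  | @cons _ w _ hadj q =>
    refine ⟨w, hadj, le_antisymm ?_ ?_⟩
    · -- `d(o, w) ≤ |q| = d(v, o) - 1`
      have h1 : G.dist o w ≤ q.length := by rw [dist_comm]; exact dist_le q
      have h2 : q.length + 1 = G.dist o v := by
        rw [dist_comm, ← hp, Walk.length_cons]
      omega
    · calc G.dist o v ≤ G.dist o w + G.dist w v := hconn.dist_triangle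
        _ ≤ G.dist o w + 1 := by
          rw [dist_eq_one_iff_adj.2 hadj.symm]

/-- The **breadth-first parent** of `v` towards `o`: a neighbour one step closer to `o`
(`o` is its own parent). [folklore] -/
noncomputable def bfsParent (hconn : G.Connected) (o v : V) : V := by
  classical
  exact if hv : v = o then o else (exists_adj_dist_add_one hconn hv).choose

/-- The parent of `o` is `o`. [folklore] -/
theorem bfsParent_self (hconn : G.Connected) (o : V) : bfsParent hconn o o = o := by
  rw [bfsParent, dif_pos rfl]

/-- The parent of `v ≠ o` is adjacent to `v`. [folklore] -/
theorem adj_bfsParent (hconn : G.Connected) {o v : V} (hv : v ≠ o) : G.Adj v (bfsParent hconn o v) := by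
  rw [bfsParent, dif_neg hv]
  exact (exists_adj_dist_add_one hconn hv).choose_spec.1

/-- The parent of `v ≠ o` is one step closer to `o`. [folklore] -/
theorem dist_bfsParent_add_one (hconn : G.Connected) {o v : V} (hv : v ≠ o) :
    G.dist o (bfsParent hconn o v) + 1 = G.dist o v := by
  rw [bfsParent, dif_neg hv]
  exact (exists_adj_dist_add_one hconn hv).choose_spec.2

/-- The depth of the `k`-th ancestor: `d(o, parent^k v) = d(o, v) - k`. [folklore] -/
theorem dist_iterate_bfsParent (hconn : G.Connected) (o v : V) (k : ℕ) :
    G.dist o ((bfsParent hconn o)^[k] v) = G.dist o v - k := by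
  induction k with
  | zero => simp
  | succ k ih =>
    rw [Function.iterate_succ_apply']
    set u := (bfsParent hconn o)^[k] v with hu
    by_cases huo : u = o
    · rw [huo, bfsParent_self, dist_self]
      have : G.dist o v - k = 0 := by rw [← ih, huo, dist_self]
      omega
    · have := dist_bfsParent_add_one hconn huo
      omega

/-- Ancestors beyond the depth are `o`. [folklore] -/
theorem iterate_bfsParent_eq_self (hconn : G.Connected) (o v : V) {k : ℕ} (hk : G.dist o v ≤ k) :
    (bfsParent hconn o)^[k] v = o := by
  have h := dist_iterate_bfsParent hconn o v k
  have h0 : G.dist o ((bfsParent hconn o)^[k] v) = 0 := by rw [h]; omega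
  rw [hconn.dist_eq_zero_iff] at h0
  exact h0.symm

/-- **The ancestor of `v` at depth `e`** (for `e ≤ d(o, v)`; for larger `e` it is `v` itself, as
`d(o,v) - e = 0`). [folklore] -/
noncomputable def atDepth (hconn : G.Connected) (o v : V) (e : ℕ) : V :=
  (bfsParent hconn o)^[G.dist o v - e] v

/-- `atDepth v (d v) = v`. [folklore] -/
theorem atDepth_dist (hconn : G.Connected) (o v : V) : atDepth hconn o v (G.dist o v) = v := by
  simp [atDepth]

/-- `atDepth v 0 = o`. [folklore] -/
theorem atDepth_zero (hconn : G.Connected) (o v : V) : atDepth hconn o v 0 = o :=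
  iterate_bfsParent_eq_self hconn o v (by simp)

/-- The ancestor at depth `e ≤ d(o, v)` has depth `e`. [folklore] -/
theorem dist_atDepth (hconn : G.Connected) (o v : V) {e : ℕ} (he : e ≤ G.dist o v) :
    G.dist o (atDepth hconn o v e) = e := by
  rw [atDepth, dist_iterate_bfsParent]
  omega

/-- Consecutive ancestors are joined by a parent edge: `atDepth v e = parent (atDepth v (e+1))`
for `e < d(o, v)`. [folklore] -/
theorem atDepth_eq_bfsParent (hconn : G.Connected) (o v : V) {e : ℕ} (he : e < G.dist o v) :
    atDepth hconn o v e = bfsParent hconn o (atDepth hconn o v (e + 1)) := by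
  rw [atDepth, atDepth, ← Function.iterate_succ_apply' (bfsParent hconn o)]
  congr 1
  omega

/-- Consecutive ancestors are adjacent. [folklore] -/
theorem adj_atDepth_succ (hconn : G.Connected) (o v : V) {e : ℕ} (he : e < G.dist o v) :
    G.Adj (atDepth hconn o v (e + 1)) (atDepth hconn o v e) := by
  rw [atDepth_eq_bfsParent hconn o v he]
  refine adj_bfsParent hconn fun h => ?_
  have := dist_atDepth hconn o v (e := e + 1) he
  rw [h, dist_self] at this
  omega

/-- **Chains from a common vertex agree below it**: if the chains of `v` and `w` meet at depth
`e₀` then they agree at every depth `e ≤ e₀`. [folklore] -/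
theorem atDepth_eq_of_atDepth_eq (hconn : G.Connected) (o : V) {v w : V} {e₀ : ℕ}
    (hv : e₀ ≤ G.dist o v) (hw : e₀ ≤ G.dist o w) (h : atDepth hconn o v e₀ = atDepth hconn o w e₀)
    {e : ℕ} (he : e ≤ e₀) : atDepth hconn o v e = atDepth hconn o w e := by
  have key : ∀ u : V, ∀ e e₀ : ℕ, e ≤ e₀ → e₀ ≤ G.dist o u →
      atDepth hconn o u e = (bfsParent hconn o)^[e₀ - e] (atDepth hconn o u e₀) := by
    intro u e e₀ he he₀
    rw [atDepth, atDepth, ← Function.iterate_add_apply]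
    congr 1
    omega
  rw [key v e e₀ he hv, key w e e₀ he hw, h]

/-! ### The edges of a chain and of a tripod -/

/-- The parent edges along the chain of `v`: `{[atDepth v (e+1), atDepth v e] : e < d(o, v)}`.
[folklore] -/
def chainEdges (hconn : G.Connected) (o v : V) : Set (Sym2 V) :=
  {z | ∃ e, e < G.dist o v ∧ z = s(atDepth hconn o v (e + 1), atDepth hconn o v e)}

/-- The vertices of the chain of `v`. [folklore] -/
def chainVerts (hconn : G.Connected) (o v : V) : Set V :=
  {u | ∃ e, e ≤ G.dist o v ∧ u = atDepth hconn o v e}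

/-- Chain edges are edges of `G`. [folklore] -/
theorem chainEdges_subset_edgeSet (hconn : G.Connected) (o v : V) :
    chainEdges hconn o v ⊆ G.edgeSet := by
  rintro _ ⟨e, he, rfl⟩
  exact adj_atDepth_succ hconn o v he

/-- The endpoints of a chain edge are chain vertices. [folklore] -/
theorem mem_chainVerts_of_mem_chainEdges (hconn : G.Connected) (o v : V) {z : Sym2 V}
    (hz : z ∈ chainEdges hconn o v) {u : V} (hu : u ∈ z) : u ∈ chainVerts hconn o v := by
  obtain ⟨e, he, rfl⟩ := hz
  rcases Sym2.mem_iff.1 hu with rfl | rfl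
  · exact ⟨e + 1, he, rfl⟩
  · exact ⟨e, he.le, rfl⟩

/-- Chain vertices have depth at most `d(o, v)`; those of depth `d(o, v)` equal `v`. [folklore] -/
theorem eq_of_mem_chainVerts_of_dist_eq (hconn : G.Connected) (o v : V) {u : V}
    (hu : u ∈ chainVerts hconn o v) (hd : G.dist o u = G.dist o v) : u = v := by
  obtain ⟨e, he, rfl⟩ := hu
  rw [dist_atDepth hconn o v he] at hd
  rw [hd, atDepth_dist]

/-- Chain vertices have depth at most `d(o, v)`. [folklore] -/
theorem dist_le_of_mem_chainVerts (hconn : G.Connected) (o v : V) {u : V}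
    (hu : u ∈ chainVerts hconn o v) : G.dist o u ≤ G.dist o v := by
  obtain ⟨e, he, rfl⟩ := hu
  rwa [dist_atDepth hconn o v he]

/-- A chain vertex is `atDepth v` of its own depth. [folklore] -/
theorem eq_atDepth_of_mem_chainVerts (hconn : G.Connected) (o v : V) {u : V}
    (hu : u ∈ chainVerts hconn o v) : u = atDepth hconn o v (G.dist o u) := by
  obtain ⟨e, he, rfl⟩ := hu
  rw [dist_atDepth hconn o v he]

/-- `v` is a chain vertex of itself. [folklore] -/
theorem self_mem_chainVerts (hconn : G.Connected) (o v : V) : v ∈ chainVerts hconn o v :=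
  ⟨G.dist o v, le_rfl, (atDepth_dist hconn o v).symm⟩

/-- The chain joins `v` to every one of its ancestors inside the chain graph, avoiding any vertex
of smaller depth. [folklore] -/
theorem exists_walk_chain (hconn : G.Connected) (o v : V) {e : ℕ} (he : e ≤ G.dist o v) :
    ∃ p : (fromEdgeSet (chainEdges hconn o v)).Walk v (atDepth hconn o v e),
      ∀ u ∈ p.support, u ∈ chainVerts hconn o v ∧ e ≤ G.dist o u := by
  -- descend from depth `d(o,v)` to depth `e`
  have key : ∀ k : ℕ, e + k ≤ G.dist o v →
      ∃ p : (fromEdgeSet (chainEdges hconn o v)).Walk (atDepth hconn o v (e + k)) (atDepth hconn o v e),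
        ∀ u ∈ p.support, u ∈ chainVerts hconn o v ∧ e ≤ G.dist o u := by
    intro k
    induction k with
    | zero =>
      intro _
      refine ⟨Walk.nil, fun u hu => ?_⟩
      rw [Walk.support_nil, List.mem_singleton] at hu
      subst hu
      exact ⟨⟨e, he, by simp⟩, by rw [Nat.add_zero, dist_atDepth hconn o v he]⟩
    | succ k ih =>
      intro hk
      obtain ⟨q, hq⟩ := ih (by omega)
      have hlt : e + k < G.dist o v := by omega
      have hadj : (fromEdgeSet (chainEdges hconn o v)).Adj (atDepth hconn o v (e + k + 1))
          (atDepth hconn o v (e + k)) := by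
        rw [fromEdgeSet_adj]
        exact ⟨⟨e + k, hlt, rfl⟩, (adj_atDepth_succ hconn o v hlt).ne⟩
      refine ⟨Walk.cons hadj q, fun u hu => ?_⟩
      rw [Walk.support_cons, List.mem_cons] at hu
      rcases hu with rfl | hu
      · exact ⟨⟨e + k + 1, hk, rfl⟩, by rw [dist_atDepth hconn o v hk]; omega⟩
      · exact hq u hu
  obtain ⟨p, hp⟩ := key (G.dist o v - e) (by omega)
  have heq : e + (G.dist o v - e) = G.dist o v := by omega
  refine ⟨p.copy (by rw [heq, atDepth_dist]) rfl, fun u hu => ?_⟩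
  rw [Walk.support_copy] at hu
  exact hp u hu

/-! ### The tripod of three chains and its median -/

section Tripod

variable (hconn : G.Connected) (o : V)

/-- The union of the three chains ("legs") of `a`, `b`, `c`. [folklore] -/
def tripodEdges (a b c : V) : Set (Sym2 V) :=
  chainEdges hconn o a ∪ chainEdges hconn o b ∪ chainEdges hconn o c

/-- The vertices of the tripod. [folklore] -/
def tripodVerts (a b c : V) : Set V :=
  chainVerts hconn o a ∪ chainVerts hconn o b ∪ chainVerts hconn o c

/-- Tripod edges are edges of `G`. [folklore] -/
theorem tripodEdges_subset_edgeSet (a b c : V) : tripodEdges hconn o a b c ⊆ G.edgeSet := by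
  rintro z ((hz | hz) | hz)
  · exact chainEdges_subset_edgeSet hconn o a hz
  · exact chainEdges_subset_edgeSet hconn o b hz
  · exact chainEdges_subset_edgeSet hconn o c hz

/-- The endpoints of tripod edges are tripod vertices. [folklore] -/
theorem mem_tripodVerts_of_mem_tripodEdges {a b c : V} {z : Sym2 V}
    (hz : z ∈ tripodEdges hconn o a b c) {u : V} (hu : u ∈ z) : u ∈ tripodVerts hconn o a b c := by
  rcases hz with (hz | hz) | hz
  · exact Or.inl (Or.inl (mem_chainVerts_of_mem_chainEdges hconn o a hz hu))
  · exact Or.inl (Or.inr (mem_chainVerts_of_mem_chainEdges hconn o b hz hu))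
  · exact Or.inr (mem_chainVerts_of_mem_chainEdges hconn o c hz hu)

/-- Tripod edges in normal form: every edge of the tripod is a parent edge
`[atDepth x (e+1), atDepth x e]` of one of the three legs `x ∈ {a, b, c}`, `e < d(o, x)`.
[folklore] -/
theorem exists_of_mem_tripodEdges {a b c : V} {z : Sym2 V} (hz : z ∈ tripodEdges hconn o a b c) :
    ∃ x, (x = a ∨ x = b ∨ x = c) ∧ ∃ e, e < G.dist o x ∧
      z = s(atDepth hconn o x (e + 1), atDepth hconn o x e) := by
  rcases hz with (⟨e, he, rfl⟩ | ⟨e, he, rfl⟩) | ⟨e, he, rfl⟩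
  · exact ⟨a, Or.inl rfl, e, he, rfl⟩
  · exact ⟨b, Or.inr (Or.inl rfl), e, he, rfl⟩
  · exact ⟨c, Or.inr (Or.inr rfl), e, he, rfl⟩

variable {hconn o}

/-- **The core separation lemma.** Let `a b c` have the common depth `R`, let the chains of `a`
and `b` agree at depth `e₀ < R` and differ above it, and let the chains of `a` and `c` differ at
every depth `> e₀` too. Then the set `{atDepth a e : e₀ < e ≤ R}` is closed under steps of the
tripod avoiding `m = atDepth a e₀`. [folklore] -/
theorem tripod_step_mem {a b c : V} {R e₀ : ℕ} (ha : G.dist o a = R) (hb : G.dist o b = R)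
    (hc : G.dist o c = R)
    (hab : ∀ e, e₀ < e → e ≤ R → atDepth hconn o a e ≠ atDepth hconn o b e)
    (hac : ∀ e, e₀ < e → e ≤ R → atDepth hconn o a e ≠ atDepth hconn o c e)
    {u w : V} (hu : ∃ e, e₀ < e ∧ e ≤ R ∧ u = atDepth hconn o a e)
    (hadj : (fromEdgeSet (tripodEdges hconn o a b c)).Adj u w) (hw : w ≠ atDepth hconn o a e₀) :
    ∃ e, e₀ < e ∧ e ≤ R ∧ w = atDepth hconn o a e := by
  obtain ⟨e, he₁, he₂, rfl⟩ := hu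
  rw [fromEdgeSet_adj] at hadj
  obtain ⟨hz, hne⟩ := hadj
  obtain ⟨x, hx, f, hf, hzf⟩ := exists_of_mem_tripodEdges hconn o hz
  have hxR : G.dist o x = R := by rcases hx with rfl | rfl | rfl <;> assumption
  have hdu : G.dist o (atDepth hconn o a e) = e := dist_atDepth hconn o a (by omega)
  -- the leg `x` passes through `u = atDepth a e`, hence agrees with `a` below depth `e`
  rcases Sym2.eq_iff.1 hzf with ⟨hu', hw'⟩ | ⟨hu', hw'⟩
  · -- `u = atDepth x (f+1)`, `w = atDepth x f` is the parent of `u`: depth `e - 1`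
    have hfe : f + 1 = e := by
      have := dist_atDepth hconn o x (e := f + 1) (by omega)
      rw [← hu', hdu] at this
      omega
    subst hfe
    have hagree : ∀ {e' : ℕ}, e' ≤ f + 1 → atDepth hconn o a e' = atDepth hconn o x e' :=
      fun {e'} he' => atDepth_eq_of_atDepth_eq hconn o (v := a) (w := x) (e₀ := f + 1)
        (by omega) (by omega) hu' he'
    refine ⟨f, ?_, by omega, ?_⟩
    · -- `f = e₀` would make `w = m`
      by_contra hfe₀
      have hf₀ : f = e₀ := by omega
      apply hw
      rw [hw', ← hagree (Nat.le_succ f), hf₀]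
    · rw [hw', ← hagree (Nat.le_succ f)]
  · -- `u = atDepth x f`, `w = atDepth x (f+1)` is a child of `u` in the leg `x`: depth `e + 1`
    have hfe : f = e := by
      have := dist_atDepth hconn o x (e := f) (by omega)
      rw [← hu', hdu] at this
      omega
    subst hfe
    -- the legs `x` and `a` agree at depth `e`; this rules out `x = b` and `x = c`
    rcases hx with rfl | rfl | rfl
    · exact ⟨f + 1, by omega, by omega, hw'⟩
    · exact absurd hu' (hab f he₁ he₂)
    · exact absurd hu' (hac f he₁ he₂)

/-- Closed sets control avoiding reachability: if `S` is closed under `Γ`-steps into vertices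
`≠ m`, then every vertex reached from `S` avoiding `m` lies in `S`. [folklore] -/
theorem AvoidReach.mem_of_closed {Γ : SimpleGraph V} {m : V} {S : Set V}
    (hS : ∀ u w, u ∈ S → Γ.Adj u w → w ≠ m → w ∈ S) {u v : V} (hu : u ∈ S)
    (h : AvoidReach Γ m u v) : v ∈ S := by
  obtain ⟨p, hp⟩ := h
  induction p with
  | nil => exact hu
  | @cons x y z hadj q ih =>
    rw [Walk.support_cons, List.mem_cons, not_or] at hp
    exact ih (hS x y hu hadj (fun h => hp.2 (h ▸ q.start_mem_support))) hp.2

/-- **The median of three leaves separates them**: for distinct vertices `a b c` at a common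
depth `R ≥ 1` there is a tripod vertex `m` of depth `< R` such that no two of `a, b, c` are
joined in the tripod by a walk avoiding `m`. [folklore] -/
theorem exists_median_separates {a b c : V} {R : ℕ} (ha : G.dist o a = R) (hb : G.dist o b = R)
    (hc : G.dist o c = R) (hab : a ≠ b) (hac : a ≠ c) (hbc : b ≠ c) :
    ∃ m ∈ tripodVerts hconn o a b c, G.dist o m < R ∧
      ¬ AvoidReach (fromEdgeSet (tripodEdges hconn o a b c)) m a b ∧
      ¬ AvoidReach (fromEdgeSet (tripodEdges hconn o a b c)) m a c ∧
      ¬ AvoidReach (fromEdgeSet (tripodEdges hconn o a b c)) m b c := by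
  classical
  -- the meeting depths of the three pairs
  have hex : ∀ x y : V, ∃ e, e ≤ R ∧ atDepth hconn o x e = atDepth hconn o y e := fun x y =>
    ⟨0, Nat.zero_le R, by rw [atDepth_zero, atDepth_zero]⟩
  let meet : V → V → ℕ := fun x y => Nat.findGreatest (fun e => atDepth hconn o x e = atDepth hconn o y e) R
  have hmeet_spec : ∀ x y, atDepth hconn o x (meet x y) = atDepth hconn o y (meet x y) := by
    intro x y
    exact Nat.findGreatest_spec (P := fun e => atDepth hconn o x e = atDepth hconn o y e)
      (Nat.zero_le R) (by rw [atDepth_zero, atDepth_zero])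
  have hmeet_le : ∀ x y, meet x y ≤ R := fun x y => Nat.findGreatest_le R
  have hmeet_max : ∀ x y e, meet x y < e → e ≤ R → atDepth hconn o x e ≠ atDepth hconn o y e :=
    fun x y e h1 h2 => Nat.findGreatest_is_greatest h1 h2
  have hmeet_symm : ∀ x y, meet x y = meet y x := by
    intro x y
    simp only [meet]
    congr 1
    ext e
    exact eq_comm
  have hmeet_lt : ∀ {x y}, x ≠ y → G.dist o x = R → G.dist o y = R → meet x y < R := by
    intro x y hxy hx hy
    refine lt_of_le_of_ne (hmeet_le x y) fun h => hxy ?_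
    have := hmeet_spec x y
    rw [h] at this
    rwa [← hx, atDepth_dist, hx, ← hy, atDepth_dist] at this
  -- the generic step: if `meet x y` is the largest of the three, `atDepth x (meet x y)` separates
  have generic : ∀ x y z : V, G.dist o x = R → G.dist o y = R → G.dist o z = R →
      x ≠ y → x ≠ z → y ≠ z → meet x z ≤ meet x y → meet y z ≤ meet x y →
      let m := atDepth hconn o x (meet x y)
      m ∈ tripodVerts hconn o x y z ∧ G.dist o m < R ∧
      ¬ AvoidReach (fromEdgeSet (tripodEdges hconn o x y z)) m x y ∧
      ¬ AvoidReach (fromEdgeSet (tripodEdges hconn o x y z)) m x z ∧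
      ¬ AvoidReach (fromEdgeSet (tripodEdges hconn o x y z)) m y z := by
    intro x y z hx hy hz hxy hxz hyz h1 h2
    set e₀ := meet x y with he₀def
    have he₀ : e₀ < R := hmeet_lt hxy hx hy
    -- the two closed sets: the legs of `x` and of `y` strictly below… above depth `e₀`
    set Dx : Set V := {u | ∃ e, e₀ < e ∧ e ≤ R ∧ u = atDepth hconn o x e} with hDx
    set Dy : Set V := {u | ∃ e, e₀ < e ∧ e ≤ R ∧ u = atDepth hconn o y e} with hDy
    have hxy' : ∀ e, e₀ < e → e ≤ R → atDepth hconn o x e ≠ atDepth hconn o y e :=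
      fun e h h' => hmeet_max x y e h h'
    have hxz' : ∀ e, e₀ < e → e ≤ R → atDepth hconn o x e ≠ atDepth hconn o z e :=
      fun e h h' => hmeet_max x z e (lt_of_le_of_lt h1 h) h'
    have hyx' : ∀ e, e₀ < e → e ≤ R → atDepth hconn o y e ≠ atDepth hconn o x e :=
      fun e h h' => (hxy' e h h').symm
    have hyz' : ∀ e, e₀ < e → e ≤ R → atDepth hconn o y e ≠ atDepth hconn o z e :=
      fun e h h' => hmeet_max y z e (lt_of_le_of_lt h2 h) h'
    have hm_eq : atDepth hconn o x e₀ = atDepth hconn o y e₀ := hmeet_spec x y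
    -- closedness
    have hDx_closed : ∀ u w, u ∈ Dx → (fromEdgeSet (tripodEdges hconn o x y z)).Adj u w →
        w ≠ atDepth hconn o x e₀ → w ∈ Dx :=
      fun u w hu hadj hw => tripod_step_mem hx hy hz hxy' hxz' hu hadj hw
    have hDy_closed : ∀ u w, u ∈ Dy → (fromEdgeSet (tripodEdges hconn o x y z)).Adj u w →
        w ≠ atDepth hconn o x e₀ → w ∈ Dy := by
      intro u w hu hadj hw
      -- the tripod of `(y, x, z)` has the same edges
      have hadj' : (fromEdgeSet (tripodEdges hconn o y x z)).Adj u w := by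
        rw [fromEdgeSet_adj] at hadj ⊢
        refine ⟨?_, hadj.2⟩
        rcases hadj.1 with (h | h) | h
        · exact Or.inl (Or.inr h)
        · exact Or.inl (Or.inl h)
        · exact Or.inr h
      rw [hm_eq] at hw
      exact tripod_step_mem hy hx hz hyx' hyz' hu hadj' hw
    -- memberships
    have hxDx : x ∈ Dx := ⟨R, he₀, le_rfl, by rw [← hx, atDepth_dist]⟩
    have hyDy : y ∈ Dy := ⟨R, he₀, le_rfl, by rw [← hy, atDepth_dist]⟩
    have hnot : ∀ {w v : V}, G.dist o w = R → G.dist o v = R → w ≠ v →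
        v ∉ {u | ∃ e, e₀ < e ∧ e ≤ R ∧ u = atDepth hconn o w e} := by
      rintro w v hw hv hwv ⟨e, -, he, hve⟩
      have : G.dist o v = e := by rw [hve, dist_atDepth hconn o w (by omega)]
      rw [hv] at this
      subst this
      rw [← hw, atDepth_dist] at hve
      exact hwv hve.symm
    refine ⟨?_, ?_, ?_, ?_, ?_⟩
    · exact Or.inl (Or.inl ⟨e₀, by omega, rfl⟩)
    · rw [dist_atDepth hconn o x (by omega)]; exact he₀
    · exact fun h => hnot hx hy hxy (h.mem_of_closed hDx_closed hxDx)
    · exact fun h => hnot hx hz hxz (h.mem_of_closed hDx_closed hxDx)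
    · exact fun h => hnot hy hz hyz (h.mem_of_closed hDy_closed hyDy)
  -- permuting the tripod
  have hperm_acb : tripodEdges hconn o a c b = tripodEdges hconn o a b c := by
    ext z; simp only [tripodEdges, Set.mem_union]; tauto
  have hperm_bca : tripodEdges hconn o b c a = tripodEdges hconn o a b c := by
    ext z; simp only [tripodEdges, Set.mem_union]; tauto
  have hvperm_acb : tripodVerts hconn o a c b = tripodVerts hconn o a b c := by
    ext z; simp only [tripodVerts, Set.mem_union]; tauto
  have hvperm_bca : tripodVerts hconn o b c a = tripodVerts hconn o a b c := by
    ext z; simp only [tripodVerts, Set.mem_union]; tauto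
  -- which pair meets deepest?
  by_cases h1 : meet a c ≤ meet a b ∧ meet b c ≤ meet a b
  · obtain ⟨hm, hd, h12, h13, h23⟩ := generic a b c ha hb hc hab hac hbc h1.1 h1.2
    exact ⟨_, hm, hd, h12, h13, h23⟩
  by_cases h2 : meet a b ≤ meet a c ∧ meet c b ≤ meet a c
  · obtain ⟨hm, hd, h12, h13, h23⟩ := generic a c b ha hc hb hac hab (Ne.symm hbc) h2.1 h2.2
    rw [hperm_acb] at h12 h13 h23
    rw [hvperm_acb] at hm
    exact ⟨_, hm, hd, h13, h12, fun h => h23 h.symm⟩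
  · -- then `meet b c` is the largest
    have h3 : meet b a ≤ meet b c ∧ meet c a ≤ meet b c := by
      rw [hmeet_symm b a, hmeet_symm c a, hmeet_symm c b] at *
      push Not at h1 h2
      constructor <;> omega
    obtain ⟨hm, hd, h12, h13, h23⟩ := generic b c a hb hc ha hbc (Ne.symm hab) (Ne.symm hac) h3.1 h3.2
    rw [hperm_bca] at h12 h13 h23
    rw [hvperm_bca] at hm
    exact ⟨_, hm, hd, fun h => h13 h.symm, fun h => h23 h.symm, h12⟩

end Tripod

end Literature.Barriers.CriticalPhenomena
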